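import Literature.Geometry.Lorentzian.LocatedLeaf
import Literature.Geometry.Lorentzian.TameFarFrame
import Summits.FinalStateConjecture.FinalStateConjecture.Statement
import HarnessLib

/-!
# Stub `stub_cores_zero` of line `far-tail-peeling-one-leaf` of crux `Capture`
# (stmt-FinalStateConjecture-10115): the `N = 0` SECTOR of CORE EXTRACTION is bookkeeping

Line `far-tail-peeling-one-leaf` (`Summits/FinalStateConjecture/FinalStateConjecture/Cruxes/Capture/Lines/
far_tail_peeling_one_leaf.lean`, skeleton v2) composes the crux `Capture` as
`stub_farFrame → stub_farTail → stub_cores → stub_engine → Capture`.  `stub_cores` (CORE EXTRACTION) says: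
pinned near-Kerr leaves plus a tame far frame yield, for every request `(η, k, ε, R′, T₁, K)`, a LOCATED
leaf (`HasLocatedLeaf`, Literature/Geometry/Lorentzian/LocatedLeaf.lean: the leaf block with an
assignment of labels to centres, every label phantom-and-unerased or thick-and-located).  With NO labels
(`N = 0`) the assignment and the alternative are indexed by `Fin 0`, so core extraction is the projection
`HasLocatedLeaf.of_isNearKerrLeaf_zero` of any pinned `0`-hole leaf beyond `J⁻(K)` — the far frame, the
accuracy `η`, the core radius `R′` and the lateness `T₁` play no role.  This file lands that sector,
stated EXPANDED (the line's `HasPinnedLeaves 𝒟 0 M₀ a₀` inlined; Theses-free).  Under the DODGE of the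
typed leaf predicate (crux dossier `Cruxes/Capture/NOTES.md` L28–L29) this is, on paper, all `stub_cores`
ever has to do: every request can be answered by the all-phantom branch over a far-parked sheet.

References: DHRT arXiv:2104.08222, §1 (chart / deviation vocabulary). [DafermosHolzegelRodnianskiTaylor2021]
-/

noncomputable section

-- the doubled `FinalStateConjecture` path component is the summit/problem naming scheme
set_option linter.dupNamespace false

namespace Summit.FinalStateConjecture.FinalStateConjecture.Theorems.BartnikGapSettling.Capture

open Set Filter Function Topology TopologicalSpace
open scoped Manifold ContDiff ENNReal
open Literature.Geometry.Lorentzian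

/-- **`N = 0` sector of CORE EXTRACTION (stub `stub_cores_zero`)**: in any development (the MGHD /
complete-`𝓘⁺` / far-frame hypotheses are carried verbatim from the line's `stub_cores` and not used),
pinned `0`-hole `(ε,k)`-near-Kerr leaves beyond every `J⁻(K)` give, for every request
`(η, k, ε, R′, T₁, K)`, a located leaf with `0` labels relative to ANY far frame — by
`HasLocatedLeaf.of_isNearKerrLeaf_zero`. DHRT arXiv:2104.08222, §1 (vocabulary).
[cite: DafermosHolzegelRodnianskiTaylor2021, §1] -/
theorem stub_cores_zero :
    ∀ (X : Type) [TopologicalSpace X] [ChartedSpace E3 X] [IsManifold (𝓡 3) ∞ X] [T2Space X]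
      [SecondCountableTopology X] [ConnectedSpace X],
      ∀ D ∈ admissibleVacuumData X, ∀ 𝒟 : VacuumCauchyDevelopment D, 𝒟.IsMaximal →
        Summit.FinalStateConjecture.HasCompleteNullInfinity 𝒟.toCauchyDevelopment →
          ∀ (M₀ a₀ : Fin 0 → ℝ),
            (∀ η : ℝ, 0 < η → ∀ (k : ℕ) (ε : ℝ≥0∞), 0 < ε → ∀ K : Set 𝒟.carrier, IsCompact K →
              ∃ (M a : Fin 0 → ℝ) (S : Set 𝒟.carrier), (∀ i, |M i - M₀ i| ≤ η ∧ |a i - a₀ i| ≤ η) ∧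
                Disjoint S (𝒟.metric.causalPast 𝒟.timeOrientation K) ∧
                  𝒟.toCauchyDevelopment.IsNearKerrLeaf k ε 0 M a S) →
              ∀ (k₀ n : ℕ) (c : Fin n → ℝ → E3) (Rt C T₀ : ℝ) (lam : ℝ → ℝ) (U : Opens E4)
                (Φ : U → 𝒟.carrier), IsTameFarFrame 𝒟.toCauchyDevelopment k₀ n c Rt C T₀ lam U Φ →
                ∀ η : ℝ, 0 < η → ∀ (k : ℕ) (ε : ℝ≥0∞), 0 < ε → ∀ (R' T₁ : ℝ) (K : Set 𝒟.carrier),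
                  IsCompact K →
                    HasLocatedLeaf 𝒟.toCauchyDevelopment c Rt T₀ U Φ 0 M₀ a₀ η k ε R' T₁ K := by
  intro X _ _ _ _ _ _ D _ 𝒟 _ _ M₀ a₀ hpin k₀ n c Rt C T₀ lam U Φ _ η hη k ε hε R' T₁ K hK
  obtain ⟨M, a, S, -, hSK, hleaf⟩ := hpin η hη k ε hε K hK
  exact HasLocatedLeaf.of_isNearKerrLeaf_zero hleaf hSK

end Summit.FinalStateConjecture.FinalStateConjecture.Theorems.BartnikGapSettling.Capture

end
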